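import Summits.KontsevichZagierPeriods.KontsevichZagierPeriods.Theorems.RootDecompZetaThreeFrontierCellZetaFourP05

/-! # `RootDecompZetaThreeFrontierCellZetaFourP06` — part 6/11 of the mechanical ≤400-line split of `cz_src_doc.lean` (sha256 4f990bc7d7dc4f98…)
Source: decomp-kz lens-1 g13 CellZetaNF_v2.lean @9c7c1e48 LEVEL 1 (§H1a chords/frames/NBCSpan, §H1b, §H4a, §H4b residues, §H5 certificate, §H8 rung 4 ⟸ (A₄); JOB C 98×98 certificate; critic CLEARED g6-20 l.1368); --supports stmt-KontsevichZagierPeriods-27141.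
Split by census-1 g10 `gen/splitlean.py`: scopes re-opened with their `open`/`variable`/`set_option` context; mathematics and declaration order unchanged. -/

set_option linter.dupNamespace false

namespace Summit.KontsevichZagierPeriods.KontsevichZagierPeriods.Cruxes.GZNormalFormWThree.GZLadder.CellZetaFour
open Set MeasureTheory Finset
open Literature.NumberTheory.Transcendental
open Summit.KontsevichZagierPeriods.KontsevichZagierPeriods.Cruxes.GZNormalFormWThree.GZLadder.RungFour
open Summit.KontsevichZagierPeriods.KontsevichZagierPeriods.Cruxes.GZNormalFormWThree.GZLadder.RotFour (mem_simplex_four_iff)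
set_option linter.unusedSimpArgs false
set_option linter.unusedVariables false
set_option linter.style.longLine false

/-- the fourteen chord forms do not vanish on `Δ₄` -/
theorem facts {t : Fin 4 → ℝ} (ht : t ∈ KZ.openOrderedSimplex 4) :
    t 0 ≠ 0 ∧ t 1 ≠ 0 ∧ t 2 ≠ 0 ∧ t 3 ≠ 0 ∧ 1 - t 0 ≠ 0 ∧ 1 - t 1 ≠ 0 ∧ 1 - t 2 ≠ 0 ∧ 1 - t 3 ≠ 0 ∧
    t 0 - t 1 ≠ 0 ∧ t 0 - t 2 ≠ 0 ∧ t 0 - t 3 ≠ 0 ∧ t 1 - t 2 ≠ 0 ∧ t 1 - t 3 ≠ 0 ∧ t 2 - t 3 ≠ 0 := by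
  obtain ⟨h3, h32, h21, h10, h0⟩ := (mem_simplex_four_iff t).1 ht
  refine ⟨?_, ?_, ?_, ?_, ?_, ?_, ?_, ?_, ?_, ?_, ?_, ?_, ?_, ?_⟩ <;> (apply ne_of_gt; linarith)

end Summit.KontsevichZagierPeriods.KontsevichZagierPeriods.Cruxes.GZNormalFormWThree.GZLadder.CellZetaFour

/-! ## §H4 explicit forms: chord forms, the NBC monomials, the dihedral points `ρ^m (δ^e t)` in closed form, and the
NBC EXPANSIONS of the 22 basis functions `B22 i = Σ_b β_ib M_b` on `Δ₄` (β from `exp/part2_out.json`, entries ±1) -/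

namespace Summit.KontsevichZagierPeriods.KontsevichZagierPeriods.Cruxes.GZNormalFormWThree.GZLadder.CellZetaFour

open Set MeasureTheory Finset
open Literature.NumberTheory.Transcendental
open Summit.KontsevichZagierPeriods.KontsevichZagierPeriods.Cruxes.GZNormalFormWThree.GZLadder.RungFour
open Summit.KontsevichZagierPeriods.KontsevichZagierPeriods.Cruxes.GZNormalFormWThree.GZLadder.Basis22 (B22 lab)
open Summit.KontsevichZagierPeriods.KontsevichZagierPeriods.Cruxes.GZNormalFormWThree.GZLadder.RotFour (mem_simplex_four_iff)
open Summit.KontsevichZagierPeriods.KontsevichZagierPeriods.Cruxes.GZNormalFormWThree.GZLadder.WordMoves (gen rotFun reflFun wordF w0001 w0011 w0101)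
open Summit.KontsevichZagierPeriods.KontsevichZagierPeriods.Cruxes.GZNormalFormWThree.GZLadder.RotFour (rot4 refl4)
open Summit.KontsevichZagierPeriods.KontsevichZagierPeriods.Cruxes.GZNormalFormWThree.GZLadder.ProdFour (Fb)

set_option linter.unusedSimpArgs false
set_option linter.unusedVariables false
set_option linter.unusedTactic false
set_option linter.unreachableTactic false
set_option linter.style.longLine false

/-- Auxiliary step `rot4_cf1` (§H4): rot4 cf1. [bookkeeping] -/
theorem rot4_cf1 {t : Fin 4 → ℝ} (ht : t ∈ KZ.openOrderedSimplex 4) :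
    rot4 t = ![1 - t 3, (t 0 - t 3) / t 0, (t 1 - t 3) / t 1, (t 2 - t 3) / t 2] := by
  obtain ⟨f0, f1, f2, f3, g0, g1, g2, g3, d01, d02, d03, d12, d13, d23⟩ := facts ht
  ext i; fin_cases i <;> simp [rot4] <;> first | (field_simp; done) | (field_simp; ring) | ring

/-- Auxiliary step `rot4_cf2` (§H4): rot4 cf2. [bookkeeping] -/
theorem rot4_cf2 {t : Fin 4 → ℝ} (ht : t ∈ KZ.openOrderedSimplex 4) :
    rot4 (rot4 t) = ![t 3 / t 2, t 3 * (1 - t 2) / (t 2 * (1 - t 3)), t 3 * (t 0 - t 2) / (t 2 * (t 0 - t 3)),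
      t 3 * (t 1 - t 2) / (t 2 * (t 1 - t 3))] := by
  obtain ⟨f0, f1, f2, f3, g0, g1, g2, g3, d01, d02, d03, d12, d13, d23⟩ := facts ht
  rw [rot4_cf1 ht]
  ext i; fin_cases i <;> simp [rot4] <;> first | (field_simp; done) | (field_simp; ring) | ring

/-- Auxiliary step `rot4_cf3` (§H4): rot4 cf3. [bookkeeping] -/
theorem rot4_cf3 {t : Fin 4 → ℝ} (ht : t ∈ KZ.openOrderedSimplex 4) :
    rot4 (rot4 (rot4 t)) = ![t 1 * (t 2 - t 3) / (t 2 * (t 1 - t 3)), (t 2 - t 3) / (t 1 - t 3),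
      (1 - t 1) * (t 2 - t 3) / ((1 - t 2) * (t 1 - t 3)), (t 0 - t 1) * (t 2 - t 3) / ((t 0 - t 2) * (t 1 - t 3))] := by
  obtain ⟨f0, f1, f2, f3, g0, g1, g2, g3, d01, d02, d03, d12, d13, d23⟩ := facts ht
  rw [rot4_cf2 ht]
  ext i; fin_cases i <;> simp [rot4] <;> first | (field_simp; done) | (field_simp; ring) | ring

/-- Auxiliary step `rot4_cfr1` (§H4): rot4 cfr1. [bookkeeping] -/
theorem rot4_cfr1 {t : Fin 4 → ℝ} (ht : t ∈ KZ.openOrderedSimplex 4) :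
    rot4 (refl4 t) = ![t 0, (t 0 - t 3) / (1 - t 3), (t 0 - t 2) / (1 - t 2), (t 0 - t 1) / (1 - t 1)] := by
  obtain ⟨f0, f1, f2, f3, g0, g1, g2, g3, d01, d02, d03, d12, d13, d23⟩ := facts ht
  ext i; fin_cases i <;> simp [rot4, refl4] <;> first | (field_simp; done) | (field_simp; ring) | ring

/-- Auxiliary step `rot4_cfr2` (§H4): rot4 cfr2. [bookkeeping] -/
theorem rot4_cfr2 {t : Fin 4 → ℝ} (ht : t ∈ KZ.openOrderedSimplex 4) :
    rot4 (rot4 (refl4 t)) = ![(1 - t 0) / (1 - t 1), (1 - t 0) * t 1 / ((1 - t 1) * t 0),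
      (1 - t 0) * (t 1 - t 3) / ((1 - t 1) * (t 0 - t 3)), (1 - t 0) * (t 1 - t 2) / ((1 - t 1) * (t 0 - t 2))] := by
  obtain ⟨f0, f1, f2, f3, g0, g1, g2, g3, d01, d02, d03, d12, d13, d23⟩ := facts ht
  rw [rot4_cfr1 ht]
  ext i; fin_cases i <;> simp [rot4] <;> first | (field_simp; done) | (field_simp; ring) | ring

/-- Auxiliary step `rot4_cfr3` (§H4): rot4 cfr3. [bookkeeping] -/
theorem rot4_cfr3 {t : Fin 4 → ℝ} (ht : t ∈ KZ.openOrderedSimplex 4) :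
    rot4 (rot4 (rot4 (refl4 t))) = ![(1 - t 2) * (t 0 - t 1) / ((1 - t 1) * (t 0 - t 2)), (t 0 - t 1) / (t 0 - t 2),
      t 2 * (t 0 - t 1) / (t 1 * (t 0 - t 2)), (t 2 - t 3) * (t 0 - t 1) / ((t 1 - t 3) * (t 0 - t 2))] := by
  obtain ⟨f0, f1, f2, f3, g0, g1, g2, g3, d01, d02, d03, d12, d13, d23⟩ := facts ht
  rw [rot4_cfr2 ht]
  ext i; fin_cases i <;> simp [rot4] <;> first | (field_simp; done) | (field_simp; ring) | ring

/-- Auxiliary step `iter1` (§H4): iter1. [bookkeeping] -/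
theorem iter1 (f : (Fin 4 → ℝ) → ℝ) : rotFun^[1] f = rotFun f := rfl
/-- Auxiliary step `iter2` (§H4): iter2. [bookkeeping] -/
theorem iter2 (f : (Fin 4 → ℝ) → ℝ) : rotFun^[2] f = rotFun (rotFun f) := rfl
/-- Auxiliary step `iter3` (§H4): iter3. [bookkeeping] -/
theorem iter3 (f : (Fin 4 → ℝ) → ℝ) : rotFun^[3] f = rotFun (rotFun (rotFun f)) := rfl

/-- Auxiliary step `wordF_0001` (§H4): word F 0001. [bookkeeping] -/
theorem wordF_0001 (p : Fin 4 → ℝ) : wordF w0001 p = 1 / p 0 * (1 / p 1) * (1 / p 2) * (1 / (1 - p 3)) := by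
  simp [wordF, w0001, Fin.prod_univ_four]

/-- Auxiliary step `wordF_0011` (§H4): word F 0011. [bookkeeping] -/
theorem wordF_0011 (p : Fin 4 → ℝ) : wordF w0011 p = 1 / p 0 * (1 / p 1) * (1 / (1 - p 2)) * (1 / (1 - p 3)) := by
  simp [wordF, w0011, Fin.prod_univ_four]

/-- Auxiliary step `wordF_0101` (§H4): word F 0101. [bookkeeping] -/
theorem wordF_0101 (p : Fin 4 → ℝ) : wordF w0101 p = 1 / p 0 * (1 / (1 - p 1)) * (1 / p 2) * (1 / (1 - p 3)) := by
  simp [wordF, w0101, Fin.prod_univ_four]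

/-- Auxiliary step `ccf1_1` (§H4): ccf1 1. [bookkeeping] -/
theorem ccf1_1 {t : Fin 4 → ℝ} (ht : t ∈ KZ.openOrderedSimplex 4) : 1 - rot4 (t) 1 = t 3 / t 0 := by
  obtain ⟨f0, f1, f2, f3, g0, g1, g2, g3, d01, d02, d03, d12, d13, d23⟩ := facts ht
  rw [rot4_cf1 ht]
  simp only [Matrix.cons_val_zero, Matrix.cons_val_one, Matrix.head_cons, Matrix.cons_val_two, Matrix.tail_cons, Matrix.cons_val_three]
  first | (field_simp; done) | (field_simp; ring) | ring

/-- Auxiliary step `ccf1_2` (§H4): ccf1 2. [bookkeeping] -/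
theorem ccf1_2 {t : Fin 4 → ℝ} (ht : t ∈ KZ.openOrderedSimplex 4) : 1 - rot4 (t) 2 = t 3 / t 1 := by
  obtain ⟨f0, f1, f2, f3, g0, g1, g2, g3, d01, d02, d03, d12, d13, d23⟩ := facts ht
  rw [rot4_cf1 ht]
  simp only [Matrix.cons_val_zero, Matrix.cons_val_one, Matrix.head_cons, Matrix.cons_val_two, Matrix.tail_cons, Matrix.cons_val_three]
  first | (field_simp; done) | (field_simp; ring) | ring

/-- Auxiliary step `ccf1_3` (§H4): ccf1 3. [bookkeeping] -/
theorem ccf1_3 {t : Fin 4 → ℝ} (ht : t ∈ KZ.openOrderedSimplex 4) : 1 - rot4 (t) 3 = t 3 / t 2 := by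
  obtain ⟨f0, f1, f2, f3, g0, g1, g2, g3, d01, d02, d03, d12, d13, d23⟩ := facts ht
  rw [rot4_cf1 ht]
  simp only [Matrix.cons_val_zero, Matrix.cons_val_one, Matrix.head_cons, Matrix.cons_val_two, Matrix.tail_cons, Matrix.cons_val_three]
  first | (field_simp; done) | (field_simp; ring) | ring

/-- Auxiliary step `ccf2_1` (§H4): ccf2 1. [bookkeeping] -/
theorem ccf2_1 {t : Fin 4 → ℝ} (ht : t ∈ KZ.openOrderedSimplex 4) : 1 - rot4 (rot4 (t)) 1 = (t 2 - t 3) / (t 2 * (1 - t 3)) := by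
  obtain ⟨f0, f1, f2, f3, g0, g1, g2, g3, d01, d02, d03, d12, d13, d23⟩ := facts ht
  rw [rot4_cf2 ht]
  simp only [Matrix.cons_val_zero, Matrix.cons_val_one, Matrix.head_cons, Matrix.cons_val_two, Matrix.tail_cons, Matrix.cons_val_three]
  first | (field_simp; done) | (field_simp; ring) | ring

/-- Auxiliary step `ccf2_2` (§H4): ccf2 2. [bookkeeping] -/
theorem ccf2_2 {t : Fin 4 → ℝ} (ht : t ∈ KZ.openOrderedSimplex 4) : 1 - rot4 (rot4 (t)) 2 = t 0 * (t 2 - t 3) / (t 2 * (t 0 - t 3)) := by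
  obtain ⟨f0, f1, f2, f3, g0, g1, g2, g3, d01, d02, d03, d12, d13, d23⟩ := facts ht
  rw [rot4_cf2 ht]
  simp only [Matrix.cons_val_zero, Matrix.cons_val_one, Matrix.head_cons, Matrix.cons_val_two, Matrix.tail_cons, Matrix.cons_val_three]
  first | (field_simp; done) | (field_simp; ring) | ring

/-- Auxiliary step `ccf2_3` (§H4): ccf2 3. [bookkeeping] -/
theorem ccf2_3 {t : Fin 4 → ℝ} (ht : t ∈ KZ.openOrderedSimplex 4) : 1 - rot4 (rot4 (t)) 3 = t 1 * (t 2 - t 3) / (t 2 * (t 1 - t 3)) := by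
  obtain ⟨f0, f1, f2, f3, g0, g1, g2, g3, d01, d02, d03, d12, d13, d23⟩ := facts ht
  rw [rot4_cf2 ht]
  simp only [Matrix.cons_val_zero, Matrix.cons_val_one, Matrix.head_cons, Matrix.cons_val_two, Matrix.tail_cons, Matrix.cons_val_three]
  first | (field_simp; done) | (field_simp; ring) | ring

/-- Auxiliary step `ccf3_1` (§H4): ccf3 1. [bookkeeping] -/
theorem ccf3_1 {t : Fin 4 → ℝ} (ht : t ∈ KZ.openOrderedSimplex 4) : 1 - rot4 (rot4 (rot4 (t))) 1 = (t 1 - t 2) / (t 1 - t 3) := by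
  obtain ⟨f0, f1, f2, f3, g0, g1, g2, g3, d01, d02, d03, d12, d13, d23⟩ := facts ht
  rw [rot4_cf3 ht]
  simp only [Matrix.cons_val_zero, Matrix.cons_val_one, Matrix.head_cons, Matrix.cons_val_two, Matrix.tail_cons, Matrix.cons_val_three]
  first | (field_simp; done) | (field_simp; ring) | ring

/-- Auxiliary step `ccf3_2` (§H4): ccf3 2. [bookkeeping] -/
theorem ccf3_2 {t : Fin 4 → ℝ} (ht : t ∈ KZ.openOrderedSimplex 4) : 1 - rot4 (rot4 (rot4 (t))) 2 = (t 1 - t 2) * (1 - t 3) / ((1 - t 2) * (t 1 - t 3)) := by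
  obtain ⟨f0, f1, f2, f3, g0, g1, g2, g3, d01, d02, d03, d12, d13, d23⟩ := facts ht
  rw [rot4_cf3 ht]
  simp only [Matrix.cons_val_zero, Matrix.cons_val_one, Matrix.head_cons, Matrix.cons_val_two, Matrix.tail_cons, Matrix.cons_val_three]
  first | (field_simp; done) | (field_simp; ring) | ring

/-- Auxiliary step `ccf3_3` (§H4): ccf3 3. [bookkeeping] -/
theorem ccf3_3 {t : Fin 4 → ℝ} (ht : t ∈ KZ.openOrderedSimplex 4) : 1 - rot4 (rot4 (rot4 (t))) 3 = (t 1 - t 2) * (t 0 - t 3) / ((t 0 - t 2) * (t 1 - t 3)) := by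
  obtain ⟨f0, f1, f2, f3, g0, g1, g2, g3, d01, d02, d03, d12, d13, d23⟩ := facts ht
  rw [rot4_cf3 ht]
  simp only [Matrix.cons_val_zero, Matrix.cons_val_one, Matrix.head_cons, Matrix.cons_val_two, Matrix.tail_cons, Matrix.cons_val_three]
  first | (field_simp; done) | (field_simp; ring) | ring

/-- Auxiliary step `ccfr1_1` (§H4): ccfr1 1. [bookkeeping] -/
theorem ccfr1_1 {t : Fin 4 → ℝ} (ht : t ∈ KZ.openOrderedSimplex 4) : 1 - rot4 (refl4 t) 1 = (1 - t 0) / (1 - t 3) := by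
  obtain ⟨f0, f1, f2, f3, g0, g1, g2, g3, d01, d02, d03, d12, d13, d23⟩ := facts ht
  rw [rot4_cfr1 ht]
  simp only [Matrix.cons_val_zero, Matrix.cons_val_one, Matrix.head_cons, Matrix.cons_val_two, Matrix.tail_cons, Matrix.cons_val_three]
  first | (field_simp; done) | (field_simp; ring) | ring

/-- Auxiliary step `ccfr1_2` (§H4): ccfr1 2. [bookkeeping] -/
theorem ccfr1_2 {t : Fin 4 → ℝ} (ht : t ∈ KZ.openOrderedSimplex 4) : 1 - rot4 (refl4 t) 2 = (1 - t 0) / (1 - t 2) := by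
  obtain ⟨f0, f1, f2, f3, g0, g1, g2, g3, d01, d02, d03, d12, d13, d23⟩ := facts ht
  rw [rot4_cfr1 ht]
  simp only [Matrix.cons_val_zero, Matrix.cons_val_one, Matrix.head_cons, Matrix.cons_val_two, Matrix.tail_cons, Matrix.cons_val_three]
  first | (field_simp; done) | (field_simp; ring) | ring

/-- Auxiliary step `ccfr1_3` (§H4): ccfr1 3. [bookkeeping] -/
theorem ccfr1_3 {t : Fin 4 → ℝ} (ht : t ∈ KZ.openOrderedSimplex 4) : 1 - rot4 (refl4 t) 3 = (1 - t 0) / (1 - t 1) := by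
  obtain ⟨f0, f1, f2, f3, g0, g1, g2, g3, d01, d02, d03, d12, d13, d23⟩ := facts ht
  rw [rot4_cfr1 ht]
  simp only [Matrix.cons_val_zero, Matrix.cons_val_one, Matrix.head_cons, Matrix.cons_val_two, Matrix.tail_cons, Matrix.cons_val_three]
  first | (field_simp; done) | (field_simp; ring) | ring

/-- Auxiliary step `ccfr2_1` (§H4): ccfr2 1. [bookkeeping] -/
theorem ccfr2_1 {t : Fin 4 → ℝ} (ht : t ∈ KZ.openOrderedSimplex 4) : 1 - rot4 (rot4 (refl4 t)) 1 = (t 0 - t 1) / ((1 - t 1) * t 0) := by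
  obtain ⟨f0, f1, f2, f3, g0, g1, g2, g3, d01, d02, d03, d12, d13, d23⟩ := facts ht
  rw [rot4_cfr2 ht]
  simp only [Matrix.cons_val_zero, Matrix.cons_val_one, Matrix.head_cons, Matrix.cons_val_two, Matrix.tail_cons, Matrix.cons_val_three]
  first | (field_simp; done) | (field_simp; ring) | ring

/-- Auxiliary step `ccfr2_2` (§H4): ccfr2 2. [bookkeeping] -/
theorem ccfr2_2 {t : Fin 4 → ℝ} (ht : t ∈ KZ.openOrderedSimplex 4) : 1 - rot4 (rot4 (refl4 t)) 2 = (t 0 - t 1) * (1 - t 3) / ((1 - t 1) * (t 0 - t 3)) := by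
  obtain ⟨f0, f1, f2, f3, g0, g1, g2, g3, d01, d02, d03, d12, d13, d23⟩ := facts ht
  rw [rot4_cfr2 ht]
  simp only [Matrix.cons_val_zero, Matrix.cons_val_one, Matrix.head_cons, Matrix.cons_val_two, Matrix.tail_cons, Matrix.cons_val_three]
  first | (field_simp; done) | (field_simp; ring) | ring

/-- Auxiliary step `ccfr2_3` (§H4): ccfr2 3. [bookkeeping] -/
theorem ccfr2_3 {t : Fin 4 → ℝ} (ht : t ∈ KZ.openOrderedSimplex 4) : 1 - rot4 (rot4 (refl4 t)) 3 = (t 0 - t 1) * (1 - t 2) / ((1 - t 1) * (t 0 - t 2)) := by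
  obtain ⟨f0, f1, f2, f3, g0, g1, g2, g3, d01, d02, d03, d12, d13, d23⟩ := facts ht
  rw [rot4_cfr2 ht]
  simp only [Matrix.cons_val_zero, Matrix.cons_val_one, Matrix.head_cons, Matrix.cons_val_two, Matrix.tail_cons, Matrix.cons_val_three]
  first | (field_simp; done) | (field_simp; ring) | ring

/-- Auxiliary step `ccfr3_1` (§H4): ccfr3 1. [bookkeeping] -/
theorem ccfr3_1 {t : Fin 4 → ℝ} (ht : t ∈ KZ.openOrderedSimplex 4) : 1 - rot4 (rot4 (rot4 (refl4 t))) 1 = (t 1 - t 2) / (t 0 - t 2) := by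
  obtain ⟨f0, f1, f2, f3, g0, g1, g2, g3, d01, d02, d03, d12, d13, d23⟩ := facts ht
  rw [rot4_cfr3 ht]
  simp only [Matrix.cons_val_zero, Matrix.cons_val_one, Matrix.head_cons, Matrix.cons_val_two, Matrix.tail_cons, Matrix.cons_val_three]
  first | (field_simp; done) | (field_simp; ring) | ring

/-- Auxiliary step `ccfr3_2` (§H4): ccfr3 2. [bookkeeping] -/
theorem ccfr3_2 {t : Fin 4 → ℝ} (ht : t ∈ KZ.openOrderedSimplex 4) : 1 - rot4 (rot4 (rot4 (refl4 t))) 2 = t 0 * (t 1 - t 2) / (t 1 * (t 0 - t 2)) := by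
  obtain ⟨f0, f1, f2, f3, g0, g1, g2, g3, d01, d02, d03, d12, d13, d23⟩ := facts ht
  rw [rot4_cfr3 ht]
  simp only [Matrix.cons_val_zero, Matrix.cons_val_one, Matrix.head_cons, Matrix.cons_val_two, Matrix.tail_cons, Matrix.cons_val_three]
  first | (field_simp; done) | (field_simp; ring) | ring

/-- Auxiliary step `ccfr3_3` (§H4): ccfr3 3. [bookkeeping] -/
theorem ccfr3_3 {t : Fin 4 → ℝ} (ht : t ∈ KZ.openOrderedSimplex 4) : 1 - rot4 (rot4 (rot4 (refl4 t))) 3 = (t 0 - t 3) * (t 1 - t 2) / ((t 1 - t 3) * (t 0 - t 2)) := by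
  obtain ⟨f0, f1, f2, f3, g0, g1, g2, g3, d01, d02, d03, d12, d13, d23⟩ := facts ht
  rw [rot4_cfr3 ht]
  simp only [Matrix.cons_val_zero, Matrix.cons_val_one, Matrix.head_cons, Matrix.cons_val_two, Matrix.tail_cons, Matrix.cons_val_three]
  first | (field_simp; done) | (field_simp; ring) | ring

/-- Auxiliary step `B22_eq_0` (§H4): B22 eq 0. [bookkeeping] -/
theorem B22_eq_0 : B22 0 = wordF w0001 := rfl
/-- Auxiliary step `B22_eq_1` (§H4): B22 eq 1. [bookkeeping] -/
theorem B22_eq_1 : B22 1 = reflFun (wordF w0001) := rfl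
/-- Auxiliary step `B22_eq_2` (§H4): B22 eq 2. [bookkeeping] -/
theorem B22_eq_2 : B22 2 = rotFun^[1] (wordF w0001) := rfl
/-- Auxiliary step `B22_eq_3` (§H4): B22 eq 3. [bookkeeping] -/
theorem B22_eq_3 : B22 3 = reflFun (rotFun^[1] (wordF w0001)) := rfl
/-- Auxiliary step `B22_eq_4` (§H4): B22 eq 4. [bookkeeping] -/
theorem B22_eq_4 : B22 4 = rotFun^[2] (wordF w0001) := rfl
/-- Auxiliary step `B22_eq_5` (§H4): B22 eq 5. [bookkeeping] -/
theorem B22_eq_5 : B22 5 = reflFun (rotFun^[2] (wordF w0001)) := rfl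
/-- Auxiliary step `B22_eq_6` (§H4): B22 eq 6. [bookkeeping] -/
theorem B22_eq_6 : B22 6 = rotFun^[3] (wordF w0001) := rfl
/-- Auxiliary step `B22_eq_7` (§H4): B22 eq 7. [bookkeeping] -/
theorem B22_eq_7 : B22 7 = wordF w0011 := rfl
/-- Auxiliary step `B22_eq_8` (§H4): B22 eq 8. [bookkeeping] -/
theorem B22_eq_8 : B22 8 = rotFun^[1] (wordF w0011) := rfl
/-- Auxiliary step `B22_eq_9` (§H4): B22 eq 9. [bookkeeping] -/
theorem B22_eq_9 : B22 9 = reflFun (rotFun^[1] (wordF w0011)) := rfl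
/-- Auxiliary step `B22_eq_10` (§H4): B22 eq 10. [bookkeeping] -/
theorem B22_eq_10 : B22 10 = rotFun^[2] (wordF w0011) := rfl
/-- Auxiliary step `B22_eq_11` (§H4): B22 eq 11. [bookkeeping] -/
theorem B22_eq_11 : B22 11 = reflFun (rotFun^[2] (wordF w0011)) := rfl
/-- Auxiliary step `B22_eq_12` (§H4): B22 eq 12. [bookkeeping] -/
theorem B22_eq_12 : B22 12 = rotFun^[3] (wordF w0011) := rfl
/-- Auxiliary step `B22_eq_13` (§H4): B22 eq 13. [bookkeeping] -/
theorem B22_eq_13 : B22 13 = reflFun (rotFun^[3] (wordF w0011)) := rfl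
/-- Auxiliary step `B22_eq_14` (§H4): B22 eq 14. [bookkeeping] -/
theorem B22_eq_14 : B22 14 = wordF w0101 := rfl
/-- Auxiliary step `B22_eq_15` (§H4): B22 eq 15. [bookkeeping] -/
theorem B22_eq_15 : B22 15 = rotFun^[1] (wordF w0101) := rfl
/-- Auxiliary step `B22_eq_16` (§H4): B22 eq 16. [bookkeeping] -/
theorem B22_eq_16 : B22 16 = reflFun (rotFun^[1] (wordF w0101)) := rfl
/-- Auxiliary step `B22_eq_17` (§H4): B22 eq 17. [bookkeeping] -/
theorem B22_eq_17 : B22 17 = rotFun^[2] (wordF w0101) := rfl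
/-- Auxiliary step `B22_eq_18` (§H4): B22 eq 18. [bookkeeping] -/
theorem B22_eq_18 : B22 18 = reflFun (rotFun^[2] (wordF w0101)) := rfl
/-- Auxiliary step `B22_eq_19` (§H4): B22 eq 19. [bookkeeping] -/
theorem B22_eq_19 : B22 19 = rotFun^[3] (wordF w0101) := rfl
/-- Auxiliary step `B22_eq_20` (§H4): B22 eq 20. [bookkeeping] -/
theorem B22_eq_20 : B22 20 = reflFun (rotFun^[3] (wordF w0101)) := rfl
/-- Auxiliary step `B22_eq_21` (§H4): B22 eq 21. [bookkeeping] -/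
theorem B22_eq_21 : B22 21 = Fb := rfl

/-- Auxiliary step `B22_mono_0` (§H4): B22 mono 0. [bookkeeping] -/
theorem B22_mono_0 {t : Fin 4 → ℝ} (ht : t ∈ KZ.openOrderedSimplex 4) : B22 0 t = 1 / ((1 - t 3) * t 0 * t 1 * t 2) := by
  obtain ⟨f0, f1, f2, f3, g0, g1, g2, g3, d01, d02, d03, d12, d13, d23⟩ := facts ht
  rw [B22_eq_0]
  simp only [wordF_0001]
  simp only [refl4, Matrix.cons_val_zero, Matrix.cons_val_one, Matrix.head_cons, Matrix.cons_val_two, Matrix.tail_cons, Matrix.cons_val_three, sub_sub_cancel, one_div]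
  first | (field_simp; done) | (field_simp; ring) | ring

/-- Auxiliary step `B22_mono_1` (§H4): B22 mono 1. [bookkeeping] -/
theorem B22_mono_1 {t : Fin 4 → ℝ} (ht : t ∈ KZ.openOrderedSimplex 4) : B22 1 t = 1 / ((1 - t 1) * (1 - t 2) * (1 - t 3) * t 0) := by
  obtain ⟨f0, f1, f2, f3, g0, g1, g2, g3, d01, d02, d03, d12, d13, d23⟩ := facts ht
  rw [B22_eq_1]
  simp only [reflFun, wordF_0001]
  simp only [refl4, Matrix.cons_val_zero, Matrix.cons_val_one, Matrix.head_cons, Matrix.cons_val_two, Matrix.tail_cons, Matrix.cons_val_three, sub_sub_cancel, one_div]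
  first | (field_simp; done) | (field_simp; ring) | ring

/-- Auxiliary step `B22_mono_2` (§H4): B22 mono 2. [bookkeeping] -/
theorem B22_mono_2 {t : Fin 4 → ℝ} (ht : t ∈ KZ.openOrderedSimplex 4) : B22 2 t = t 3 * t 3 / ((1 - t 3) * (t 0 - t 3) * t 0 * (t 1 - t 3) * t 1 * t 2) := by
  obtain ⟨f0, f1, f2, f3, g0, g1, g2, g3, d01, d02, d03, d12, d13, d23⟩ := facts ht
  rw [B22_eq_2]
  rw [iter1]
  simp only [rotFun, wordF_0001]
  rw [ccf1_3 ht]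
  rw [rot4_cf1 ht]
  simp only [refl4, Matrix.cons_val_zero, Matrix.cons_val_one, Matrix.head_cons, Matrix.cons_val_two, Matrix.tail_cons, Matrix.cons_val_three, sub_sub_cancel, one_div]
  first | (field_simp; done) | (field_simp; ring) | ring

/-- Auxiliary step `B22_mono_3` (§H4): B22 mono 3. [bookkeeping] -/
theorem B22_mono_3 {t : Fin 4 → ℝ} (ht : t ∈ KZ.openOrderedSimplex 4) : B22 3 t = (1 - t 0) * (1 - t 0) / ((1 - t 1) * (1 - t 2) * (1 - t 3) * (t 0 - t 2) * (t 0 - t 3) * t 0) := by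
  obtain ⟨f0, f1, f2, f3, g0, g1, g2, g3, d01, d02, d03, d12, d13, d23⟩ := facts ht
  rw [B22_eq_3]
  rw [iter1]
  simp only [reflFun, rotFun, wordF_0001]
  rw [ccfr1_3 ht]
  rw [rot4_cfr1 ht]
  simp only [refl4, Matrix.cons_val_zero, Matrix.cons_val_one, Matrix.head_cons, Matrix.cons_val_two, Matrix.tail_cons, Matrix.cons_val_three, sub_sub_cancel, one_div]
  first | (field_simp; done) | (field_simp; ring) | ring

/-- Auxiliary step `B22_mono_4` (§H4): B22 mono 4. [bookkeeping] -/
theorem B22_mono_4 {t : Fin 4 → ℝ} (ht : t ∈ KZ.openOrderedSimplex 4) : B22 4 t = (t 2 - t 3) * (t 2 - t 3) / ((1 - t 2) * (1 - t 3) * (t 0 - t 2) * (t 0 - t 3) * (t 1 - t 3) * t 1 * t 2) := by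
  obtain ⟨f0, f1, f2, f3, g0, g1, g2, g3, d01, d02, d03, d12, d13, d23⟩ := facts ht
  rw [B22_eq_4]
  rw [iter2]
  simp only [rotFun, wordF_0001]
  rw [ccf2_3 ht]
  rw [rot4_cf2 ht, rot4_cf1 ht]
  simp only [refl4, Matrix.cons_val_zero, Matrix.cons_val_one, Matrix.head_cons, Matrix.cons_val_two, Matrix.tail_cons, Matrix.cons_val_three, sub_sub_cancel, one_div]
  first | (field_simp; done) | (field_simp; ring) | ring

/-- Auxiliary step `B22_mono_5` (§H4): B22 mono 5. [bookkeeping] -/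
theorem B22_mono_5 {t : Fin 4 → ℝ} (ht : t ∈ KZ.openOrderedSimplex 4) : B22 5 t = (t 0 - t 1) * (t 0 - t 1) / ((1 - t 1) * (1 - t 2) * (t 0 - t 2) * (t 0 - t 3) * t 0 * (t 1 - t 3) * t 1) := by
  obtain ⟨f0, f1, f2, f3, g0, g1, g2, g3, d01, d02, d03, d12, d13, d23⟩ := facts ht
  rw [B22_eq_5]
  rw [iter2]
  simp only [reflFun, rotFun, wordF_0001]
  rw [ccfr2_3 ht]
  rw [rot4_cfr2 ht, rot4_cfr1 ht]
  simp only [refl4, Matrix.cons_val_zero, Matrix.cons_val_one, Matrix.head_cons, Matrix.cons_val_two, Matrix.tail_cons, Matrix.cons_val_three, sub_sub_cancel, one_div]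
  first | (field_simp; done) | (field_simp; ring) | ring

end Summit.KontsevichZagierPeriods.KontsevichZagierPeriods.Cruxes.GZNormalFormWThree.GZLadder.CellZetaFour
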